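import Literature.Analysis.FluidPDE.LerayHopfBoundedContinuation
import Literature.Analysis.FluidPDE.LerayHopfRegularIntervalClassical
import Literature.Analysis.FluidPDE.ClassicalSolutionGlue
import HarnessLib

/-!
# Continuation of a bounded classical representative of a Leray–Hopf solution past its end

Analysis/FluidPDE **proofs file** (theorems only: no definitions, no named facts, no `sorry`).
Leray's continuation step for *epochs issued from the initial time* (Leray 1934, §§19–24, §33;
Robinson–Rodrigo–Sadowski 2016, Thm. 8.17 and the proof of Thm. 12.3; the argument of the tree's
`hasSmoothExtensionPast_of_bounded_of_local_H1_theory`, here keeping the bounds of the extension):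
let `u` be a Leray–Hopf weak solution on `ℝ³ × [0, T)` (`ν > 0`) and let `(V, P)` be a classical
solution on `[0, β) × ℝ³`, `0 < β ≤ T`, with `u(t) = V(t)` a.e. for every `t ∈ [0, β)` and
`‖V‖ ≤ M` on `[0, β) × ℝ³`. Then `(V, P)` continues, with bounds, strictly past `β`:

* `IsClassicalNSSolutionOn.exists_glue_Ico_right` — gluing classical solutions on nested time sets
  `[a, b_n)` with right ends exhausting `[a, β)` (companion of `exists_glue_Ioc_right`);
* `lintegral_serrin_top_ne_top_of_ae_bound₀` — the Serrin integral (`r = ∞`) of an essentially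
  bounded solution is finite;
* `exists_classical_extension_of_bounded_rep` — there are `b > β` and a classical solution
  `(V', P')` on `[0, b) × ℝ³` with `V' 0 = V 0`, `u(t) = V'(t)` a.e. for `t ∈ [0, min b T)`, and
  `V'` bounded on every `[0, τ] × ℝ³`, `τ < b` (the solution is `H¹`-regular on `(0, β]` by
  `leray_continuation_H1_holds` in the Serrin class `L²L^∞`; Leray's regular solution from `u(s)`
  at a good time `s` close to `β` — `leray_local_regular_H1_holds`, lifespan uniform in `s` —
  coincides with `u(s + ·)` by `serrin_weak_strong_uniqueness_holds`, is bounded with all its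
  derivatives away from `s`, reaches past `β`, and glues to `V`, `IsClassicalNSSolutionOn.glue`).

Used for Lei–Zhang 2011, Thm. 1.4 with smooth data (path of `LeiZhang2011_regularity_bmoStream`).

## References

* J. Leray, Acta Math. 63 (1934), §§19–24, §33. [Leray1934]
* J. C. Robinson, J. L. Rodrigo, W. Sadowski, *The Three-Dimensional Navier–Stokes Equations*,
  CUP (2016), Thms. 6.10, 6.15, 8.17, proof of Thm. 12.3. [RobinsonRodrigoSadowski2016]
* W. S. Ożański, B. C. Pooley, in LMS Lecture Notes 452 (2018), Thm. 6.30, Cor. 6.16.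
  [OzanskiPooley2018]
-/

noncomputable section

open MeasureTheory Set Function Filter Topology
open scoped ENNReal NNReal

namespace Literature.Analysis.FluidPDE

/-! ### Gluing classical solutions on nested time sets `[a, b_n)`, `b_n ↑ β` -/

section GlueRight

variable {E : Type*} [NormedAddCommGroup E] [InnerProductSpace ℝ E] [FiniteDimensional ℝ E]
variable {ν : ℝ}

/-- Time derivatives within `[a, β)` and within `[a, b)`, `b ≤ β`, agree at times `t < b` for
fields agreeing on `[a, b)` (derivatives within sets coinciding near `t`). [folklore] -/
theorem timeDerivWithin_Ico_eq_Ico_of_eqOn {X F : Type*} [NormedAddCommGroup F] [NormedSpace ℝ F]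
    {a b β t : ℝ} {w₁ w₂ : ℝ → X → F} (hbβ : b ≤ β) (hat : a ≤ t) (htb : t < b)
    (heq : ∀ τ ∈ Ico a b, w₁ τ = w₂ τ) (x : X) :
    timeDerivWithin (Ico a β) w₁ t x = timeDerivWithin (Ico a b) w₂ t x := by
  simp only [timeDerivWithin_apply]
  have h1 : Ico a β ∩ Iio b = Ico a b := by
    ext τ
    simp only [mem_inter_iff, mem_Ico, mem_Iio]
    constructor
    · rintro ⟨⟨h1, -⟩, h3⟩; exact ⟨h1, h3⟩
    · rintro ⟨h1, h2⟩; exact ⟨⟨h1, h2.trans_le hbβ⟩, h2⟩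
  have e1 : derivWithin (fun s => w₁ s x) (Ico a β) t =
      derivWithin (fun s => w₁ s x) (Ico a b) t := by
    rw [← derivWithin_inter (Iio_mem_nhds htb), h1]
  rw [e1]
  exact derivWithin_congr (fun τ hτ => congrFun (heq τ hτ) x) (congrFun (heq t ⟨hat, htb⟩) x)

/-- **Gluing classical solutions on nested time sets with a common closed left end.** Let
`(V n, P n)` be classical solutions (same `ν`, same force) on `[a, b n)`, whose right ends
exhaust `[a, β)` (`b n ≤ β`, and every `t < β` has `t < b n` for some `n`), with velocities
agreeing on the common parts. Then there is a classical solution `(v, p)` on `[a, β)` with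
`v = V n` on `[a, b n)` for every `n`. Companion of `exists_glue_Ioc_right`. [folklore] -/
theorem IsClassicalNSSolutionOn.exists_glue_Ico_right {a β : ℝ} {f : ℝ → E → E} {b : ℕ → ℝ}
    {V : ℕ → ℝ → E → E} {P : ℕ → ℝ → E → ℝ} (hbβ : ∀ n, b n ≤ β)
    (hb : ∀ t, t < β → ∃ n, t < b n)
    (hV : ∀ n, IsClassicalNSSolutionOn (Ico a (b n)) ν f (V n) (P n))
    (hagree : ∀ m n, ∀ t ∈ Ico a (min (b m) (b n)), V m t = V n t) :
    ∃ (v : ℝ → E → E) (p : ℝ → E → ℝ), IsClassicalNSSolutionOn (Ico a β) ν f v p ∧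
      ∀ n, ∀ t ∈ Ico a (b n), v t = V n t := by
  classical
  set N : ℝ → ℕ := fun t => if h : ∃ n, t < b n then Nat.find h else 0 with hN_def
  have hN : ∀ t, t < β → t < b (N t) := by
    intro t ht
    have h := hb t ht
    simp only [hN_def, dif_pos h]
    exact Nat.find_spec h
  set v : ℝ → E → E := fun t => V (N t) t with hv_def
  set p : ℝ → E → ℝ := fun t x => P (N t) t x - P (N t) t 0 with hp_def
  have hvn : ∀ n, ∀ t ∈ Ico a (b n), v t = V n t := by
    intro n t ht
    have htβ : t < β := ht.2.trans_le (hbβ n)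
    exact hagree (N t) n t ⟨ht.1, lt_min (hN t htβ) ht.2⟩
  have hdtn : ∀ m n, ∀ t ∈ Ico a (min (b m) (b n)), ∀ x,
      timeDerivWithin (Ico a (b m)) (V m) t x = timeDerivWithin (Ico a (b n)) (V n) t x := by
    intro m n t ht x
    have htm : t < b m := ht.2.trans_le (min_le_left _ _)
    have htn : t < b n := ht.2.trans_le (min_le_right _ _)
    have hmin : min (b m) (b n) ≤ β := (min_le_left _ _).trans (hbβ m)
    have h1 : timeDerivWithin (Ico a β) (V m) t x = timeDerivWithin (Ico a (b m)) (V m) t x :=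
      timeDerivWithin_Ico_eq_Ico_of_eqOn (hbβ m) ht.1 htm (fun τ _ => rfl) x
    have h3 : timeDerivWithin (Ico a β) (V m) t x =
        timeDerivWithin (Ico a (min (b m) (b n))) (V n) t x :=
      timeDerivWithin_Ico_eq_Ico_of_eqOn hmin ht.1 ht.2 (fun τ hτ => hagree m n τ hτ) x
    have h4 : timeDerivWithin (Ico a β) (V n) t x =
        timeDerivWithin (Ico a (min (b m) (b n))) (V n) t x :=
      timeDerivWithin_Ico_eq_Ico_of_eqOn hmin ht.1 ht.2 (fun τ _ => rfl) x
    have h5 : timeDerivWithin (Ico a β) (V n) t x = timeDerivWithin (Ico a (b n)) (V n) t x :=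
      timeDerivWithin_Ico_eq_Ico_of_eqOn (hbβ n) ht.1 htn (fun τ _ => rfl) x
    rw [← h1, h3, ← h4, h5]
  have hpn : ∀ n, ∀ t ∈ Ico a (b n), ∀ x, p t x = P n t x - P n t 0 := by
    intro n t ht x
    have htβ : t < β := ht.2.trans_le (hbβ n)
    have hm : t ∈ Ico a (b (N t)) := ⟨ht.1, hN t htβ⟩
    exact (hV (N t)).pressure_sub_apply_zero_eq_of_timeDerivWithin_eq (hV n) hm ht
      (hagree (N t) n t ⟨ht.1, lt_min (hN t htβ) ht.2⟩)
      (hdtn (N t) n t ⟨ht.1, lt_min (hN t htβ) ht.2⟩) x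
  have hdt0 : ∀ n, ∀ t ∈ Ico a (b n), ∀ x,
      timeDerivWithin (Ico a β) v t x = timeDerivWithin (Ico a (b n)) (V n) t x := fun n t ht x =>
    timeDerivWithin_Ico_eq_Ico_of_eqOn (hbβ n) ht.1 ht.2 (hvn n) x
  have hpiece : ∀ n, Ico a β ×ˢ (univ : Set E) ∩ Iio (b n) ×ˢ univ = Ico a (b n) ×ˢ univ := by
    intro n
    ext ⟨t, x⟩
    simp only [mem_inter_iff, mem_prod, mem_Ico, mem_univ, and_true, mem_Iio]
    constructor
    · rintro ⟨⟨h1, -⟩, h3⟩; exact ⟨h1, h3⟩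
    · rintro ⟨h1, h2⟩; exact ⟨⟨h1, h2.trans_le (hbβ n)⟩, h2⟩
  have hsmooth : ∀ (w : ℝ → E → ℝ) (W : ℕ → ℝ → E → ℝ),
      (∀ n, IsSmoothSpaceTimeOn (Ico a (b n)) (W n)) →
      (∀ n, ∀ t ∈ Ico a (b n), ∀ x, w t x = W n t x) → IsSmoothSpaceTimeOn (Ico a β) w := by
    intro w W hW hwW
    refine contDiffOn_of_locally_contDiffOn fun z hz => ?_
    obtain ⟨n, hn⟩ := hb z.1 hz.1.2
    refine ⟨Iio (b n) ×ˢ univ, isOpen_Iio.prod isOpen_univ, ⟨hn, mem_univ _⟩, ?_⟩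
    rw [hpiece n]
    exact (hW n).congr fun z' hz' => hwW n z'.1 hz'.1 z'.2
  have hsmoothE : ∀ (w : ℝ → E → E) (W : ℕ → ℝ → E → E),
      (∀ n, IsSmoothSpaceTimeOn (Ico a (b n)) (W n)) →
      (∀ n, ∀ t ∈ Ico a (b n), w t = W n t) → IsSmoothSpaceTimeOn (Ico a β) w := by
    intro w W hW hwW
    refine contDiffOn_of_locally_contDiffOn fun z hz => ?_
    obtain ⟨n, hn⟩ := hb z.1 hz.1.2
    refine ⟨Iio (b n) ×ˢ univ, isOpen_Iio.prod isOpen_univ, ⟨hn, mem_univ _⟩, ?_⟩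
    rw [hpiece n]
    exact (hW n).congr fun z' hz' => by
      show w z'.1 z'.2 = W n z'.1 z'.2
      rw [hwW n z'.1 hz'.1]
  refine ⟨v, p, ⟨?_, ?_, ?_, ?_⟩, hvn⟩
  · exact hsmoothE v V (fun n => (hV n).smooth_velocity) hvn
  · exact hsmooth p (fun n t x => P n t x - P n t 0)
      (fun n => (hV n).smooth_pressure.sub_apply_zero) hpn
  · intro t ht x
    obtain ⟨n, hn⟩ := hb t ht.2
    have htn : t ∈ Ico a (b n) := ⟨ht.1, hn⟩
    have hgrad : gradient (p t) x = gradient (P n t) x := by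
      rw [show p t = fun y => P n t y - P n t 0 from funext (hpn n t htn), gradient_sub_const]
    rw [hdt0 n t htn x, hvn n t htn, hgrad]
    exact (hV n).momentum t htn x
  · intro t ht
    obtain ⟨n, hn⟩ := hb t ht.2
    rw [hvn n t ⟨ht.1, hn⟩]
    exact (hV n).divFree t ⟨ht.1, hn⟩

end GlueRight

/-! ### The continuation past the end of a bounded classical representative -/

section Continuation

variable {ν T : ℝ} {u₀ : EuclideanSpace ℝ (Fin 3) → EuclideanSpace ℝ (Fin 3)}
  {u : ℝ → EuclideanSpace ℝ (Fin 3) → EuclideanSpace ℝ (Fin 3)}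

/-- The Serrin integral with `r = ∞` of a solution essentially bounded on `(0, L)` is finite
(`lintegral_serrin_top_ne_top_of_ae_bound` without the time shift). [folklore] -/
theorem lintegral_serrin_top_ne_top_of_ae_bound₀ {L M : ℝ}
    (hbd : ∀ t ∈ Ioo 0 L, ∀ᵐ x ∂volume, ‖u t x‖ ≤ M) :
    ∫⁻ t in Ioo 0 L, ENNReal.ofReal ((eLpNorm (u t) ∞ volume).toReal ^
      (2 / (1 - (3 / (∞ : ℝ≥0∞)).toReal))) ≠ ⊤ := by
  have h := lintegral_serrin_top_ne_top_of_ae_bound (u := u) (s := 0) (L := L) (M := M)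
    (fun t ht => by simpa only [add_zero] using hbd t ht)
  simpa only [add_zero] using h

/-- **A bounded classical representative of a Leray–Hopf solution issued from the initial time
continues, with bounds, strictly past its end.** Let `u` be Leray–Hopf on `ℝ³ × [0, T)`
(`ν > 0`), `(V, P)` classical on the time set `[0, β)`, `0 < β ≤ T`, with `u(t) = V(t)` a.e.
for every `t ∈ [0, β)` and `‖V(t, x)‖ ≤ M` on `[0, β) × ℝ³`. Then there are `b > β` and a
classical solution `(V', P')` on `[0, b)` with `V'(0) = V(0)`, `u(t) = V'(t)` a.e. for every
`t ∈ [0, min b T)`, and `V'` bounded on `[0, τ] × ℝ³` for every `τ < b`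
(Leray 1934, §33; Robinson–Rodrigo–Sadowski 2016, Thm. 8.17 and proof of Thm. 12.3). [cite: RobinsonRodrigoSadowski2016, Thm. 8.17 with Thms. 6.10, 6.15 (proof of Thm. 12.3)] -/
theorem exists_classical_extension_of_bounded_rep (hν : 0 < ν) (hLH : IsLerayHopfOn T ν 0 u₀ u)
    {β : ℝ} (hβ : 0 < β) (hβT : β ≤ T)
    {V : ℝ → EuclideanSpace ℝ (Fin 3) → EuclideanSpace ℝ (Fin 3)}
    {P : ℝ → EuclideanSpace ℝ (Fin 3) → ℝ} (hV : IsClassicalNSSolutionOn (Ico 0 β) ν 0 V P)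
    (hrep : ∀ t ∈ Ico 0 β, u t =ᵐ[volume] V t) {M : ℝ} (hM : ∀ t ∈ Ico 0 β, ∀ x, ‖V t x‖ ≤ M) :
    ∃ b : ℝ, β < b ∧ ∃ (V' : ℝ → EuclideanSpace ℝ (Fin 3) → EuclideanSpace ℝ (Fin 3))
      (P' : ℝ → EuclideanSpace ℝ (Fin 3) → ℝ),
      IsClassicalNSSolutionOn (Ico 0 b) ν 0 V' P' ∧ V' 0 = V 0 ∧
      (∀ t ∈ Ico 0 (min b T), u t =ᵐ[volume] V' t) ∧
      ∀ τ < b, ∃ M' : ℝ, ∀ t ∈ Icc 0 τ, ∀ x, ‖V' t x‖ ≤ M' := by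
  obtain ⟨c, hc, hL2⟩ := tao2011_H1_local_almost_regular_holds
  obtain ⟨c₀, hc₀, hpack⟩ := leray_local_regular_H1_holds
  -- `u` is essentially bounded on `(0, β)`, hence `H¹`-regular on `(0, β]`
  have hbd : ∀ t ∈ Ioo 0 β, ∀ᵐ x ∂volume, ‖u t x‖ ≤ M := fun t ht => by
    filter_upwards [hrep t ⟨ht.1.le, ht.2⟩] with x hx
    rw [hx]; exact hM t ⟨ht.1.le, ht.2⟩ x
  have hLHβ : IsLerayHopfOn β ν 0 u₀ u := hLH.of_le hβT
  have hA := lintegral_serrin_top_ne_top_of_ae_bound₀ (u := u) hbd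
  have hreg : IsH1RegularOn (Ioc 0 β) u :=
    leray_continuation_H1_holds ν β hν hβ u₀ u hLHβ fun α β' hα hαβ' hβ' hregI =>
      limsup_eH1NormSq_lt_top_of_serrin hL2 hc hν hLHβ (r := ∞) (by simp) hA hα hαβ' hβ' hregI
  -- a uniform `H¹` bound on `[β/2, β]` and the lifespan
  obtain ⟨Atop, hAtop, hH1⟩ := hreg.exists_forall_le isCompact_Icc
    (fun t ht => ⟨by linarith [ht.1], ht.2⟩ : Icc (β / 2) β ⊆ Ioc 0 β)
  set A : ℝ := Atop.toReal + 1 with hAdef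
  have hA0 : 0 ≤ A := by positivity
  have hAM : Atop ≤ ENNReal.ofReal A :=
    calc Atop = ENNReal.ofReal Atop.toReal := (ENNReal.ofReal_toReal hAtop.ne).symm
      _ ≤ ENNReal.ofReal A := ENNReal.ofReal_le_ofReal (by rw [hAdef]; linarith)
  set d : ℝ := c₀ * ν ^ 3 / (A ^ 2 + 1) with hddef
  have hd : 0 < d := by positivity
  have hAd : A ^ 2 * d ≤ c₀ * ν ^ 3 := by
    rw [hddef, mul_div_assoc', div_le_iff₀ (by positivity)]
    nlinarith [sq_nonneg A, mul_pos hc₀ (pow_pos hν 3)]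
  -- a good time `s ∈ (max (β/2) (β - d/2), β)`
  have hlo0 : 0 ≤ max (β / 2) (β - d / 2) := (by linarith : 0 ≤ β / 2).trans (le_max_left _ _)
  have hlo : max (β / 2) (β - d / 2) < β := max_lt (by linarith) (by linarith)
  obtain ⟨s, hs, hLHs⟩ := hLH.exists_isLerayHopfOn_restart_Ioo hν.le hlo0 hlo hβT
  have hs2 : β / 2 < s := (le_max_left _ _).trans_lt hs.1
  have hsd : β - d / 2 < s := (le_max_right _ _).trans_lt hs.1
  have hs0 : 0 < s := by linarith
  -- Leray's regular solution from `u s` on `[0, d]`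
  have hu2 : MemLp (u s) 2 volume := hLH.memLp s ⟨hs0.le, hs.2.le.trans hβT⟩
  have hdiv : IsWeaklyDivFree (u s) := hLHs.isWeaklyDivFree_datum (by linarith [hs.2])
  have hAσ : eWeakGradL2Sq (u s) ≤ ENNReal.ofReal A :=
    (le_add_self.trans (hH1 s ⟨hs2.le, hs.2.le⟩)).trans hAM
  obtain ⟨w, q, hw, -, hwreg, hns, hcl⟩ := hpack hν hd hu2 hdiv hA0 hAσ hAd
  -- weak–strong uniqueness on `(0, d']`, `d' = min d (T - s)`
  set d' : ℝ := min d (T - s) with hd'def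
  have hd' : 0 < d' := lt_min hd (by linarith [hs.2])
  have hLHs' : IsLerayHopfOn d' ν 0 (u s) (fun τ => u (τ + s)) := hLHs.of_le (min_le_right _ _)
  have hwLH : IsLerayHopfOn d' ν 0 (u s) w := hw.of_le (min_le_left _ _)
  have hS : MemLqLp ∞ 6 w (Ioo 0 d') :=
    (memLqLp_top_six_of_isH1RegularOn_Icc hwreg fun τ hτ => hw.memLp τ hτ).mono_set
      (Ioo_subset_Ioo_right (min_le_left _ _))
  have hqr : 2 / (∞ : ℝ≥0∞) + 3 / 6 ≤ 1 := by
    rw [ENNReal.div_top, zero_add]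
    exact ENNReal.div_le_of_le_mul (by norm_num)
  have hae : ∀ τ ∈ Ioc 0 d', u (τ + s) =ᵐ[volume] w τ := fun τ hτ =>
    serrin_weak_strong_uniqueness_holds hν hd' hwLH hu2 (q := ∞) (r := 6) (by norm_num) hqr hS
      hLHs' τ hτ
  -- the bounds of `w` on `[δ, d]`, `δ = (β - s)/2`
  set δ : ℝ := (β - s) / 2 with hδdef
  have hδ : 0 < δ := by rw [hδdef]; linarith [hs.2]
  have hδd : δ ≤ d := by rw [hδdef]; linarith
  obtain ⟨-, -, hsup, -⟩ := hcl δ hδ hδd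
  obtain ⟨C, hC⟩ := hsup 0
  have hwbd : ∀ τ ∈ Icc δ d, ∀ x, ‖w τ x‖ ≤ C := fun τ hτ x => by
    have h := hC τ hτ x
    rwa [norm_iteratedFDeriv_zero] at h
  -- the two classical pieces agree on `(s + δ, β)`
  have hns' : IsClassicalNSSolutionOn (Ioo (s + δ) (s + d)) ν 0 (fun t => w (t + -s))
      (fun t => q (t + -s)) := by
    have h := hns.comp_add_right (-s)
    have h0 : (fun t => (0 : ℝ → EuclideanSpace ℝ (Fin 3) → EuclideanSpace ℝ (Fin 3)) (t + -s)) =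
        0 := rfl
    rw [h0] at h
    exact h.mono (fun t ht => ⟨by simp only; linarith [ht.1], by simp only; linarith [ht.2]⟩)
      (uniqueDiffOn_Ioo _ _)
  have hagree : ∀ t ∈ Ioo (s + δ) β, V t = w (t + -s) := by
    intro t ht
    have htβ : t ∈ Ico 0 β := ⟨by linarith [ht.1], ht.2⟩
    have htd : t + -s ∈ Ioc 0 d' :=
      ⟨by linarith [ht.1], le_min (by linarith [ht.2]) (by linarith [ht.2])⟩
    have h1 : u t =ᵐ[volume] w (t + -s) := by
      have h := hae (t + -s) htd
      rwa [show t + -s + s = t by ring] at h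
    exact eq_of_ae_eq_of_continuous (hV.contDiff_velocity htβ).continuous
      (hns.contDiff_velocity ⟨htd.1, htd.2.trans (min_le_left _ _)⟩).continuous
      ((hrep t htβ).symm.trans h1)
  have hglue := hV.glue hns' (by linarith) (by rw [hδdef]; linarith [hs.2]) (by linarith) hagree
  -- the extension
  refine ⟨s + d, by linarith, _, _, hglue, by simp [hβ], fun t ht => ?_, fun τ hτ => ?_⟩
  · -- a.e. agreement with `u` on `[0, min (s + d) T)`
    by_cases htβ : t < β
    · simp only [htβ, if_true]
      exact hrep t ⟨ht.1, htβ⟩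
    · simp only [htβ, if_false]
      push Not at htβ
      have h1 : t < s + d := ht.2.trans_le (min_le_left _ _)
      have h2 : t < T := ht.2.trans_le (min_le_right _ _)
      have htd : t + -s ∈ Ioc 0 d' := ⟨by linarith [hs.2], le_min (by linarith) (by linarith)⟩
      have h := hae (t + -s) htd
      rwa [show t + -s + s = t by ring] at h
  · -- bounds on `[0, τ]`, `τ < s + d`
    refine ⟨max M C, fun t ht x => ?_⟩
    by_cases htβ : t < β
    · simp only [htβ, if_true]
      exact (hM t ⟨ht.1, htβ⟩ x).trans (le_max_left _ _)
    · simp only [htβ, if_false]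
      push Not at htβ
      have htd : t + -s ∈ Icc δ d := ⟨by rw [hδdef]; linarith, by linarith [ht.2]⟩
      exact (hwbd _ htd x).trans (le_max_right _ _)

end Continuation

end Literature.Analysis.FluidPDE
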